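import Literature.AnabelianGeometry.EtaleTheta.Discharge.Sec2InertiaClauseThetaLevel
import Literature.AnabelianGeometry.SemiGraphs.TemperedDecompositionCompact
import HarnessLib

/-!
# [EtTh] §1/§2: the CUSP LAWS of the once-punctured setting — «the unique cusp `x` of `X^log`»,
# «the cusp is `K`-rational» (a continuous section of `D_x ↠ G_K`), «`D_x → Π^Θ_X` maps `I_x` onto `Δ_Θ`»

S. Mochizuki, *The étale theta function and its Frobenioid-theoretic manifestations*, Publ. RIMS **45**
(2009) [EtTh]: §1 p. 11 («a once-punctured elliptic curve», «of type `(1,1)`»), Def. 2.1 preamble p. 35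
(printed 261) «Let us write `x` for the unique cusp of `X^log`. Then there is a natural injective [outer]
homomorphism `D_x → Π^Θ_X` — where `D_x ⊆ Π_X` is the decomposition group associated to `x` — which maps
the inertia group `I_x ⊆ D_x` isomorphically onto `Δ_Θ`. Thus, we have exact sequences
`1 → Δ_X → Π_X → G_K → 1`; `1 → Δ_Θ → D̄_x → G_K → 1`», Prop. 2.2 (ii) p. 37 («the set of splittings of
`D_x ↠ G_K` is a torsor …»; the cusp of `X` is `K`-rational) [cite: MochizukiEtTh2009, Def 2.1 p.35].

Cell abc-iut, layer L2, seat abc-iut-L2-t7 (gen 4) — OWNER of the parameter bundle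
`ThetaSetting.OncePuncturedData` (`SettingBridge.lean`).  This is the 13:00Z (2026-08-26) v-next census
filing for the three ★ items the census assigns to that bundle (VNEXT-CENSUS-L2-draft v1, drafter
abc-iut-L2-t3: C16 «unique cusp», C9 «`sect x`», C3 «inertia position»), in the DEFS-FREEZE class (c)
shape — ONE `Prop`-valued PREDICATE BUNDLE over the EXISTING fields of `ThetaSetting`, no field added to
any frozen structure, no constructor site of `OncePuncturedData` touched (the tree has four, all in
non-vacuity model files, at two of which clause C3 is refuted — `SettingModelChiCensusClauses`,
`SettingModelTateCensusClauses` — so C3 cannot be a structure field without deleting accepted theorems):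

* `ThetaSetting.CuspLaws D` — (C16) `cusp_unique`: any two cusps of `X^log` coincide («the unique cusp»,
  type `(1,1)`); (C9) `exists_continuous_section`: for a cusp `x`, a CONTINUOUS SECTION `s : G_K → D_x` of
  `aug` (shape (B) of abc-iut-L2-d3's `Sec2SplittingOfSection`, the print input «the cusp is `K`-rational»);
  (C3) `map_toTheta_inertia`: `toTheta(I_x) = Δ_Θ` — the `l`-free ROOT-FIELD form of abc-iut-w6-d059's
  `Sec2InertiaClauseThetaLevel` (≡ the per-`l` clauses `toHat(I_x) ⊔ barKerHat l = barThetaHat l` for all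
  `l > 0` when `D_x` is compact, `inertiaClause_forall_iff_map_toTheta`).
* ADAPTERS, so that every binder of record is one projection away: `CuspLaws.existsUnique_cusp`,
  `CuspLaws.eq_of_isCusp`, `CuspLaws.mem_cuspDecompFamily_iff` (the bridge's cusp family is ONE
  `Π^tp_X`-conjugacy class), `CuspLaws.exists_section` (the quadruple `(s, hs, hsa, hsc)`),
  `CuspLaws.inertiaClause_of_isCompact` / `CuspLaws.inertiaClause` (per-`l` hIx for every `l > 0`; the
  compactness of `D_x` is FREE from `e : OncePuncturedData` by abc-iut-L3's
  `TemperedCurve.decompCompact_of_groupLevelData`), `OncePuncturedData.isCompact_decomp`,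
  `PiCData.inertia_sup_barKer_of_cuspLaws` (the binder `hIx` of `PiCData.coverDataAx`).

HONEST FRAMING: a predicate, asserted for no instance here (non-vacuity lives in the model files:
its C9/C16 legs hold and its C3 leg fails at the χ-models' toral cusp; all three hold at the
commutator-axis cusp of `SettingModel2CommutatorCusp`); nothing of [EtTh] is asserted; no side is taken
on [IUTchIII] Cor. 3.12; typed ≠ proved.
-/

noncomputable section

namespace Literature.AnabelianGeometry.EtaleTheta

open Literature.AnabelianGeometry.SemiGraphs _root_.Topology
open scoped Pointwise

namespace ThetaSetting

variable {p : ℕ} [Fact p.Prime]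

/-- **The cusp laws of the once-punctured [EtTh] §1 setting** (v-next census items C16 / C9 / C3 for the
parameter bundle `OncePuncturedData`, as a class-(c) predicate over the existing fields): (C16) the cusp of
`X^log` is unique («Let us write `x` for the unique cusp of `X^log`», Def. 2.1 p. 35; `X` of type `(1,1)`,
§1 p. 11); (C9) for a cusp `x` the surjection `D_x ↠ G_K` has a continuous section (the cusp is
`K`-rational, Prop. 2.2 (ii) p. 37); (C3) «`D_x → Π^Θ_X` maps the inertia group `I_x ⊆ D_x` isomorphically
onto `Δ_Θ`» (Def. 2.1 p. 35) in the onto-form `toTheta(I_x) = Δ_Θ` in the root fields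
`toTheta`, `thetaToEll` (`Δ_Θ = Ker(thetaToEll)`). [cite: MochizukiEtTh2009, Def 2.1 p.35] -/
@[mk_iff]
structure CuspLaws (D : ThetaSetting p) : Prop where
  /-- (C16) «the unique cusp of `X^log`» (Def. 2.1 p. 35): any two cusps coincide. -/
  cusp_unique : ∀ x x' : D.Pt, D.IsCusp x → D.IsCusp x' → x' = x
  /-- (C9) the cusp is `K`-rational: `D_x ↠ G_K` admits a continuous group-theoretic section
  (Prop. 2.2 (ii) p. 37, «splittings of `D_x ↠ G_K`»). -/
  exists_continuous_section : ∀ x : D.Pt, D.IsCusp x →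
    ∃ s : ↥D.GK →* D.PiTemp, Continuous s ∧ (∀ σ, s σ ∈ D.decomp x) ∧ ∀ σ, D.aug (s σ) = (σ : GQp p)
  /-- (C3) «`D_x → Π^Θ_X` maps `I_x` isomorphically onto `Δ_Θ`» (Def. 2.1 p. 35), onto-form in the root
  fields: `toTheta(I_x) = Δ_Θ = Ker((Π^tp_X)^Θ ↠ (Π^tp_X)^ell)`. -/
  map_toTheta_inertia : ∀ x : D.Pt, D.IsCusp x → (D.inertia x).map D.toTheta = D.DeltaTheta

namespace CuspLaws

variable {D : ThetaSetting p} (hL : D.CuspLaws)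
include hL

/-! ### (C16) consequences: the cusp, and the cusp family of the bridge -/

/-- Two cusps of `X^log` are equal. [cite: MochizukiEtTh2009, Def 2.1 p.35] -/
theorem eq_of_isCusp {x x' : D.Pt} (hx : D.IsCusp x) (hx' : D.IsCusp x') : x' = x :=
  hL.cusp_unique x x' hx hx'

/-- With the parameter bundle's «a cusp exists» (P2): `X^log` has EXACTLY ONE cusp.
[cite: MochizukiEtTh2009, Def 2.1 p.35] -/
theorem existsUnique_cusp (e : D.OncePuncturedData) : ∃! x : D.Pt, D.IsCusp x := by
  obtain ⟨x, hx⟩ := e.exists_cusp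
  exact ⟨x, hx, fun x' hx' => hL.cusp_unique x x' hx hx'⟩

/-- The decomposition groups of cusps are the ONE group `D_x` (for the cusp `x`): every representative
decomposition group of a cusp equals `D_x`. [cite: MochizukiEtTh2009, Def 2.1 p.35] -/
theorem decomp_eq_of_isCusp {x x' : D.Pt} (hx : D.IsCusp x) (hx' : D.IsCusp x') :
    D.decomp x' = D.decomp x := by
  rw [hL.eq_of_isCusp hx hx']

/-- The cusp family of the bridge `toOncePuncturedTemperedGroup` («any decomposition group of a cusp»,
§1 p. 13) is a SINGLE `Π^tp_X`-conjugacy class: `H` belongs to it iff `H = g D_x g⁻¹` for some `g`.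
[cite: MochizukiEtTh2009, §1 p.13] -/
theorem mem_cuspDecompFamily_iff {x : D.Pt} (hx : D.IsCusp x) (H : Subgroup D.PiTemp) :
    H ∈ D.cuspDecompFamily ↔ ∃ g : D.PiTemp, H = (D.decomp x).map (MulAut.conj g).toMonoidHom := by
  constructor
  · rintro ⟨x', hx', g, rfl⟩
    exact ⟨g, by rw [hL.decomp_eq_of_isCusp hx hx']⟩
  · rintro ⟨g, rfl⟩
    exact ⟨x, hx, g, rfl⟩

/-- Every cuspidal decomposition group of the curve layer ([SemiAnbd] §6 p. 71: a conjugate of `D_{x'}`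
for a cusp `x'`) is a conjugate of THE `D_x`. [cite: MochizukiSemiAnbd2006, §6 p.71] -/
theorem exists_eq_conj_of_isCuspidalDecompositionGroup {x : D.Pt} (hx : D.IsCusp x)
    {H : Subgroup D.PiTemp} (hH : D.toTemperedCurve.IsCuspidalDecompositionGroup H) :
    ∃ γ : ConjAct D.PiTemp, H = γ • D.decomp x := by
  obtain ⟨x', hx', γ, rfl⟩ := hH
  exact ⟨γ, by rw [hL.eq_of_isCusp hx hx']⟩

/-! ### (C9) consequences: the section quadruple of record -/

/-- The section of `D_x ↠ G_K` in the binder shape `(s, hs, hsa, hsc)` of abc-iut-L2-d3's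
`Sec2SplittingOfSection` / `Sec2CuspStabModel`. [cite: MochizukiEtTh2009, Prop 2.2(ii) p.37] -/
theorem exists_section {x : D.Pt} (hx : D.IsCusp x) :
    ∃ s : ↥D.GK →* D.PiTemp, (∀ σ, s σ ∈ D.decomp x) ∧ (∀ σ, D.aug (s σ) = (σ : GQp p)) ∧
      Continuous s := by
  obtain ⟨s, hsc, hs, hsa⟩ := hL.exists_continuous_section x hx
  exact ⟨s, hs, hsa, hsc⟩

/-- `D_x ↠ G_K` is onto: the image of `D_x` under `aug` is all of `G_K` (from the section; this is the
parameter (P4) `map_aug_decomp` of `OncePuncturedData`, here a CONSEQUENCE of (C9) together with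
`range aug = G_K`). [cite: MochizukiEtTh2009, Prop 2.2(ii) p.37] -/
theorem map_aug_decomp {x : D.Pt} (hx : D.IsCusp x) :
    (D.decomp x).map D.aug.toMonoidHom = D.GK := by
  obtain ⟨s, hs, hsa, -⟩ := hL.exists_section hx
  apply le_antisymm
  · rintro _ ⟨g, -, rfl⟩
    have hg : D.aug g ∈ D.aug.toMonoidHom.range := ⟨g, rfl⟩
    rw [D.range_aug] at hg
    exact hg
  · intro σ hσ
    exact ⟨s ⟨σ, hσ⟩, hs _, hsa ⟨σ, hσ⟩⟩

/-! ### (C3) consequences: the per-`l` inertia clauses and the `hIx` binder -/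

/-- (C3) in abc-iut-w6-d059's spelling `toTheta(I_x) = Ker(thetaToEll)`.
[cite: MochizukiEtTh2009, Def 2.1 p.35] -/
theorem map_toTheta_inertia_eq_ker {x : D.Pt} (hx : D.IsCusp x) :
    (D.inertia x).map D.toTheta = D.thetaToEll.ker :=
  hL.map_toTheta_inertia x hx

/-- **The per-`l` §1-side inertia clause, every `l > 0`**, for a cusp with compact decomposition group:
`toHat(I_x) ⊔ barKerHat l = barThetaHat l` (abc-iut-w6-d059's `inertiaClause_of_map_toTheta`).
[cite: MochizukiEtTh2009, Def 2.1 p.35] -/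
theorem inertiaClause_of_isCompact {x : D.Pt} (hx : D.IsCusp x)
    (hcpt : IsCompact (D.decomp x : Set D.PiTemp)) (l : ℕ) (hl : 0 < l) :
    (D.inertia x).map D.toHat.toMonoidHom ⊔ D.barKerHat l = D.barThetaHat l :=
  D.inertiaClause_of_map_toTheta x hcpt (hL.map_toTheta_inertia_eq_ker hx) l hl

end CuspLaws

/-- Under the parameter bundle every decomposition group of the curve layer is COMPACT (abc-iut-L3's
[SemiAnbd] Thm 6.8 sub-DAG: `Π^tp_X` tempered and Galois-countable ⇒ `D_x` compact,
`TemperedCurve.decompCompact_of_groupLevelData`) — so the census's «compact `D_x`» binder needs no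
clause. [cite: MochizukiSemiAnbd2006, §6 p.71] -/
theorem OncePuncturedData.isCompact_decomp {D : ThetaSetting p} (e : D.OncePuncturedData) (x : D.Pt) :
    IsCompact (D.decomp x : Set D.PiTemp) :=
  D.toTemperedCurve.decompCompact_of_groupLevelData e.toGroupLevelData x

namespace CuspLaws

variable {D : ThetaSetting p} (hL : D.CuspLaws)
include hL

/-- **The per-`l` inertia clause for every `l > 0` from the cusp laws and the parameter bundle**
(compactness of `D_x` supplied by `e`). [cite: MochizukiEtTh2009, Def 2.1 p.35] -/
theorem inertiaClause (e : D.OncePuncturedData) {x : D.Pt} (hx : D.IsCusp x) (l : ℕ) (hl : 0 < l) :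
    (D.inertia x).map D.toHat.toMonoidHom ⊔ D.barKerHat l = D.barThetaHat l :=
  hL.inertiaClause_of_isCompact hx (e.isCompact_decomp x) l hl

/-- The whole per-`l` family (all `l > 0`) is EQUIVALENT to (C3) at a cusp, given the bundle
(abc-iut-w6-d059's `inertiaClause_forall_iff_map_toTheta`): the predicate records exactly print's
`l`-free sentence, nothing finer. [cite: MochizukiEtTh2009, Def 2.1 p.35] -/
theorem forall_inertiaClause (e : D.OncePuncturedData) {x : D.Pt} (hx : D.IsCusp x) :
    ∀ l, 0 < l → (D.inertia x).map D.toHat.toMonoidHom ⊔ D.barKerHat l = D.barThetaHat l :=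
  (D.inertiaClause_forall_iff_map_toTheta x (e.isCompact_decomp x)).mpr
    (hL.map_toTheta_inertia_eq_ker hx)

end CuspLaws

/-- Conversely, at a cusp with compact `D_x` the per-`l` family for all `l > 0` GIVES (C3) — so a datum
satisfying abc-iut-L2-t10's per-`l` binders for every `l` already satisfies the `l`-free law.
[cite: MochizukiEtTh2009, Def 2.1 p.35] -/
theorem map_toTheta_inertia_of_forall_inertiaClause {D : ThetaSetting p} (x : D.Pt)
    (hcpt : IsCompact (D.decomp x : Set D.PiTemp))
    (h : ∀ l, 0 < l → (D.inertia x).map D.toHat.toMonoidHom ⊔ D.barKerHat l = D.barThetaHat l) :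
    (D.inertia x).map D.toTheta = D.DeltaTheta :=
  (D.inertiaClause_forall_iff_map_toTheta x hcpt).mp h

/-- **Assembling the cusp laws from the binders of record**: unique cusp, a continuous section at each
cusp, and the per-`l` inertia clauses for all `l > 0` (with the bundle supplying compactness).
[cite: MochizukiEtTh2009, Def 2.1 p.35] -/
theorem cuspLaws_of_binders {D : ThetaSetting p} (e : D.OncePuncturedData)
    (huniq : ∀ x x' : D.Pt, D.IsCusp x → D.IsCusp x' → x' = x)
    (hsect : ∀ x : D.Pt, D.IsCusp x → ∃ s : ↥D.GK →* D.PiTemp,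
      Continuous s ∧ (∀ σ, s σ ∈ D.decomp x) ∧ ∀ σ, D.aug (s σ) = (σ : GQp p))
    (hIx : ∀ x : D.Pt, D.IsCusp x →
      ∀ l, 0 < l → (D.inertia x).map D.toHat.toMonoidHom ⊔ D.barKerHat l = D.barThetaHat l) :
    D.CuspLaws where
  cusp_unique := huniq
  exists_continuous_section := hsect
  map_toTheta_inertia x hx :=
    map_toTheta_inertia_of_forall_inertiaClause x (e.isCompact_decomp x) (hIx x hx)

namespace PiCData

variable {D : ThetaSetting p} {PiC : Type} [Group PiC] [TopologicalSpace PiC] [IsTopologicalGroup PiC]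
  [T2Space PiC] (I : D.PiCData PiC)

/-- **The binder `hIx` of `PiCData.coverDataAx` from the cusp laws**: for every profinite input bundle
`I` over `D`, the parameter bundle `e`, a cusp `x` and every `l > 0`:
`(D_x ∩ Δ_C) · barKer l = barTheta l` inside `Π_C`. [cite: MochizukiEtTh2009, Def 2.1 p.35] -/
theorem inertia_sup_barKer_of_cuspLaws (l : ℕ) (hl : 0 < l) (e : D.OncePuncturedData)
    (hL : D.CuspLaws) {x : D.Pt} (hx : D.IsCusp x) :
    (I.Dx x ⊓ I.augGK.ker) ⊔ I.barKer l = I.barTheta l :=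
  I.inertia_sup_barKer_of_map_toTheta l hl e x (e.isCompact_decomp x)
    (hL.map_toTheta_inertia_eq_ker hx)

end PiCData

end ThetaSetting

end Literature.AnabelianGeometry.EtaleTheta

end
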